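import Mathlib
import HarnessLib
import Summits.Ventures.LatticeQCDFlow.Exactness.U1MultiStepLeapfrogHMCErgodic

/-!
# One short trajectory per cycle suffices: any HMC schedule on `U(1)` lattice gauge fields that contains a short-trajectory step converges from every start

HONEST FRAMING: exact (Metropolis-corrected) sampling algorithms for lattice gauge theory;
figures of merit are autocorrelation/cost numbers at stated couplings and volumes; no
continuum-physics claim.

Venture `LatticeQCDFlow` (cell pub-lqcd), topic `Exactness`, FANOUT row 9 (eng-latcore, the
engine `latflow.core.u1_2d.U1Field2D.hmc_trajectory(β, τ, nstep)` called with VARYING `(τ, nstep)` —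
the design rule behind `tau_jitter` / mixed trajectory lengths, Mackenzie 1989).  NEW WORK of the
cell over part 2 (`U1MultiStepLeapfrogHMCErgodic.u1LeapfrogHMCN_minorised`: the `n`-step kernel is
Doeblin in one step when `4·Lip(g)·ε·n² ≤ 3`; `u1LeapfrogHMCN_comp_uniformlyErgodic`) and row 9's minorisation algebra (`RefreshScan`:
`minorised_comp_left`, `minorised_comp_right`, `uniformlyErgodic_of_minorised`;
`DoeblinUniqueness.invariant_unique_of_minorised`).  Nothing is cited as a fact.

Part 2 says nothing about LONG trajectories (`4·Lip(g)·ε·n² > 3`), where fixed lengths can resonate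
(row 2's `FreeFieldHMCResonance`).  What survives is a SCHEDULE statement: a Doeblin step keeps its
minorant when ANY exact Markov kernels are run before and after it.  Hence:

* **`u1LeapfrogHMCN_sandwich_minorised`** — for exact Markov kernels `η₁` (before) and `η₂` (after),
  `η₂ ∘ₖ K_n ∘ₖ η₁` dominates `δ • (Haar^{⊗ι} η₂)` from every configuration;
* **`u1LeapfrogHMCN_sandwich_uniformlyErgodic`** / **`u1LeapfrogHMCN_sandwich_invariant_unique`** —
  if `η₁`, `η₂` leave `e^{−S}·Haar^{⊗ι}` invariant, the cycle converges to `π_S` geometrically in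
  total variation from EVERY initial law and `π_S` is its unique invariant probability law;
* **`u1LeapfrogHMCN_shortLong_uniformlyErgodic`** — THE DESIGN RULE: one short trajectory
  (`4Kεn² ≤ 3`) followed by one trajectory of ANY length and step count (`ε'`, `n'`, any measurable
  increment `g'` — exact by `u1LeapfrogHMCN_invariant`, nothing else asked of it) converges from
  every start; the long trajectory can only help, never destroy ergodicity.

NOT CLAIMED: any rate (the bound is the short step's `δ`, the long steps are not credited);
continuous `tau_jitter` (a mixture over `ε`, not a cycle — not typed); `SU(N)`; floating point.
-/

noncomputable section

namespace Summit.Ventures.LatticeQCDFlow.Exactness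

open MeasureTheory ProbabilityTheory ProbabilityTheory.Kernel Set
open Literature.MathematicalPhysics.QuantumFieldTheory
open scoped ENNReal NNReal

section Schedules

variable {ι : Type*} [Fintype ι] {ε κ : ℝ} {g : (ι → Circle) → ι → ℝ} {b : ℝ} {n : ℕ} {K : ℝ≥0}
  {S : (ι → Circle) → ℝ} {s : ℝ}

/-- **A short-trajectory HMC step keeps its Doeblin minorant inside any schedule**: for Markov
kernels `η₁` (run before) and `η₂` (run after), `(η₂ ∘ₖ K_n ∘ₖ η₁)(U, ·) ≥ δ • (Haar^{⊗ι} ∘ η₂)`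
from EVERY `U`, with the `δ > 0` of `u1LeapfrogHMCN_minorised`. -/
theorem u1LeapfrogHMCN_sandwich_minorised (hε : 0 < ε) (hκ : 0 < κ) (hn : 1 ≤ n) (hg : Measurable g)
    (hgK : LipschitzWith K g) (hshort : 4 * (K : ℝ) * ε * (n : ℝ) ^ 2 ≤ 3) (hb0 : 0 ≤ b)
    (hb : ∀ u l, ‖g u l‖ ≤ b) (hS : Measurable S) (hs : ∀ u, |S u| ≤ s)
    (η₁ η₂ : Kernel (ι → Circle) (ι → Circle)) [IsMarkovKernel η₁] [IsMarkovKernel η₂] :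
    ∃ δ : ℝ≥0∞, 0 < δ ∧ ∀ u,
      δ • (Measure.pi (fun _ : ι => haarProbability (Circle))).bind η₂ ≤
        (η₂ ∘ₖ (u1LeapfrogHMCN ε κ hg S n ∘ₖ η₁)) u := by
  obtain ⟨δ, hδ0, hmin⟩ := u1LeapfrogHMCN_minorised hε hκ hn hg hgK hshort hb0 hb hS hs
  refine ⟨δ, hδ0, fun u => ?_⟩
  have h1 := fun a => minorised_comp_right hmin η₁ a
  exact minorised_comp_left h1 η₂ u

/-- **ANY SCHEDULE AROUND A SHORT TRAJECTORY CONVERGES FROM EVERY START.**  `η₁`, `η₂` Markov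
kernels leaving `e^{−S}·Haar^{⊗ι}` invariant (further HMC trajectories of any length, over-relaxation,
heat baths, …); the short step as in `u1LeapfrogHMCN_minorised`.  Then there is `δ ∈ (0, 1]` with
`|μ₀(η₂ K_n η₁)ᵗ(A) − π_S(A)| ≤ (1 − δ)ᵗ` for every initial law `μ₀`, every `t`, every set `A`. -/
theorem u1LeapfrogHMCN_sandwich_uniformlyErgodic (hε : 0 < ε) (hκ : 0 < κ) (hn : 1 ≤ n)
    (hg : Measurable g) (hgK : LipschitzWith K g) (hshort : 4 * (K : ℝ) * ε * (n : ℝ) ^ 2 ≤ 3)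
    (hb0 : 0 ≤ b) (hb : ∀ u l, ‖g u l‖ ≤ b) (hS : Measurable S) (hs : ∀ u, |S u| ≤ s)
    (η₁ η₂ : Kernel (ι → Circle) (ι → Circle)) [IsMarkovKernel η₁] [IsMarkovKernel η₂]
    (hη₁ : Invariant η₁ ((Measure.pi fun _ : ι => haarProbability (Circle)).withDensity
      fun u => ENNReal.ofReal (Real.exp (-S u))))
    (hη₂ : Invariant η₂ ((Measure.pi fun _ : ι => haarProbability (Circle)).withDensity
      fun u => ENNReal.ofReal (Real.exp (-S u)))) :
    ∃ δ : ℝ, 0 < δ ∧ δ ≤ 1 ∧ ∀ (μ₀ : Measure (ι → Circle))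
      [IsProbabilityMeasure μ₀] (t : ℕ) (A : Set (ι → Circle)),
      |((fun m : Measure (ι → Circle) =>
          m.bind (η₂ ∘ₖ (u1LeapfrogHMCN ε κ hg S n ∘ₖ η₁)))^[t] μ₀).real A
          - (u1GibbsLaw S).real A| ≤ (1 - δ) ^ t := by
  haveI : Fact (0 < κ) := ⟨hκ⟩
  haveI := isProbabilityMeasure_u1GibbsLaw (ι := ι) hs
  obtain ⟨δ, hδ0, hmin⟩ := u1LeapfrogHMCN_sandwich_minorised hε hκ hn hg hgK hshort hb0 hb hS hs η₁ η₂
  have hH : Measurable fun z : (ι → Circle) × (ι → ℝ) => S z.1 + u1Kinetic κ z.2 :=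
    (hS.comp measurable_fst).add ((measurable_u1Kinetic κ).comp measurable_snd)
  haveI : Fact (Measurable fun z : (ι → Circle) × (ι → ℝ) => S z.1 + u1Kinetic κ z.2) := ⟨hH⟩
  haveI : IsMarkovKernel (u1LeapfrogHMCN ε κ hg S n) := by unfold u1LeapfrogHMCN; infer_instance
  have hδ1 : δ ≤ 1 := by
    have h := Measure.le_iff'.1 (hmin fun _ => 1) univ
    rwa [Measure.smul_apply, smul_eq_mul, measure_univ, measure_univ, mul_one] at h
  have hδtop : δ ≠ ⊤ := ne_top_of_le_ne_top ENNReal.one_ne_top hδ1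
  have hinv : Invariant (η₂ ∘ₖ (u1LeapfrogHMCN ε κ hg S n ∘ₖ η₁)) (u1GibbsLaw S) :=
    (invariant_smul hη₂ _).comp ((u1LeapfrogHMCN_invariant_gibbsLaw hκ hg hS n).comp (invariant_smul hη₁ _))
  refine ⟨δ.toReal, ENNReal.toReal_pos hδ0.ne' hδtop,
    ENNReal.toReal_le_of_le_ofReal zero_le_one (by rwa [ENNReal.ofReal_one]), fun μ₀ _ t A => ?_⟩
  exact uniformlyErgodic_of_minorised hmin hinv μ₀ t A

/-- **… and `π_S` is the unique invariant probability law of the schedule.** -/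
theorem u1LeapfrogHMCN_sandwich_invariant_unique (hε : 0 < ε) (hκ : 0 < κ) (hn : 1 ≤ n)
    (hg : Measurable g) (hgK : LipschitzWith K g) (hshort : 4 * (K : ℝ) * ε * (n : ℝ) ^ 2 ≤ 3)
    (hb0 : 0 ≤ b) (hb : ∀ u l, ‖g u l‖ ≤ b) (hS : Measurable S) (hs : ∀ u, |S u| ≤ s)
    (η₁ η₂ : Kernel (ι → Circle) (ι → Circle)) [IsMarkovKernel η₁] [IsMarkovKernel η₂]
    (hη₁ : Invariant η₁ ((Measure.pi fun _ : ι => haarProbability (Circle)).withDensity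
      fun u => ENNReal.ofReal (Real.exp (-S u))))
    (hη₂ : Invariant η₂ ((Measure.pi fun _ : ι => haarProbability (Circle)).withDensity
      fun u => ENNReal.ofReal (Real.exp (-S u))))
    {π' : Measure (ι → Circle)} [IsProbabilityMeasure π']
    (hπ' : Invariant (η₂ ∘ₖ (u1LeapfrogHMCN ε κ hg S n ∘ₖ η₁)) π') : π' = u1GibbsLaw S := by
  haveI : Fact (0 < κ) := ⟨hκ⟩
  haveI := isProbabilityMeasure_u1GibbsLaw (ι := ι) hs
  obtain ⟨δ, hδ0, hmin⟩ := u1LeapfrogHMCN_sandwich_minorised hε hκ hn hg hgK hshort hb0 hb hS hs η₁ η₂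
  have hH : Measurable fun z : (ι → Circle) × (ι → ℝ) => S z.1 + u1Kinetic κ z.2 :=
    (hS.comp measurable_fst).add ((measurable_u1Kinetic κ).comp measurable_snd)
  haveI : Fact (Measurable fun z : (ι → Circle) × (ι → ℝ) => S z.1 + u1Kinetic κ z.2) := ⟨hH⟩
  haveI : IsMarkovKernel (u1LeapfrogHMCN ε κ hg S n) := by unfold u1LeapfrogHMCN; infer_instance
  have hinv : Invariant (η₂ ∘ₖ (u1LeapfrogHMCN ε κ hg S n ∘ₖ η₁)) (u1GibbsLaw S) :=
    (invariant_smul hη₂ _).comp ((u1LeapfrogHMCN_invariant_gibbsLaw hκ hg hS n).comp (invariant_smul hη₁ _))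
  exact invariant_unique_of_minorised hmin hδ0 hinv hπ'

/-- **THE DESIGN RULE: ONE SHORT TRAJECTORY, THEN ONE OF ANY LENGTH.**  The cycle "short `n`-step
trajectory (`4Kεn² ≤ 3`), then an `n'`-step trajectory of ANY step `ε'` with ANY measurable increment
`g'` and any `κ' > 0`" converges to `π_S` from every start: the long trajectory is exact
(`u1LeapfrogHMCN_invariant`) and that is all that is asked of it. -/
theorem u1LeapfrogHMCN_shortLong_uniformlyErgodic (hε : 0 < ε) (hκ : 0 < κ) (hn : 1 ≤ n)
    (hg : Measurable g) (hgK : LipschitzWith K g) (hshort : 4 * (K : ℝ) * ε * (n : ℝ) ^ 2 ≤ 3)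
    (hb0 : 0 ≤ b) (hb : ∀ u l, ‖g u l‖ ≤ b) (hS : Measurable S) (hs : ∀ u, |S u| ≤ s)
    {ε' κ' : ℝ} (hκ' : 0 < κ') {g' : (ι → Circle) → ι → ℝ} (hg' : Measurable g') (n' : ℕ) :
    ∃ δ : ℝ, 0 < δ ∧ δ ≤ 1 ∧ ∀ (μ₀ : Measure (ι → Circle))
      [IsProbabilityMeasure μ₀] (t : ℕ) (A : Set (ι → Circle)),
      |((fun m : Measure (ι → Circle) =>
          m.bind (u1LeapfrogHMCN ε' κ' hg' S n' ∘ₖ u1LeapfrogHMCN ε κ hg S n))^[t] μ₀).real A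
          - (u1GibbsLaw S).real A| ≤ (1 - δ) ^ t := by
  haveI : Fact (0 < κ') := ⟨hκ'⟩
  have hH' : Measurable fun z : (ι → Circle) × (ι → ℝ) => S z.1 + u1Kinetic κ' z.2 :=
    (hS.comp measurable_fst).add ((measurable_u1Kinetic κ').comp measurable_snd)
  haveI : Fact (Measurable fun z : (ι → Circle) × (ι → ℝ) => S z.1 + u1Kinetic κ' z.2) := ⟨hH'⟩
  haveI : IsMarkovKernel (u1LeapfrogHMCN ε' κ' hg' S n') := by unfold u1LeapfrogHMCN; infer_instance
  exact u1LeapfrogHMCN_comp_uniformlyErgodic hε hκ hn hg hgK hshort hb0 hb hS hs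
    (u1LeapfrogHMCN ε' κ' hg' S n') (u1LeapfrogHMCN_invariant hκ' hg' hS n')

end Schedules

/-! ## The Wilson instance of the design rule -/

section Wilson

variable {d L N : ℕ} (ρ : Circle →* Matrix (Fin N) (Fin N) ℂ)

/-- **ON THE `U(1)` TORUS: one short trajectory then one of any length converges to the Wilson measure
from every start** (any continuous representation, any real `β`). -/
theorem wilson_u1LeapfrogHMCN_shortLong_uniformlyErgodic [NeZero L] (hρ : Continuous ρ) (β : ℝ)
    {ε κ : ℝ} (hε : 0 < ε) (hκ : 0 < κ) {n : ℕ} (hn : 1 ≤ n)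
    {g : GaugeConfig d L (Circle) → Edge d L → ℝ} (hg : Measurable g) {K : ℝ≥0}
    (hgK : LipschitzWith K g) (hshort : 4 * (K : ℝ) * ε * (n : ℝ) ^ 2 ≤ 3)
    {b : ℝ} (hb0 : 0 ≤ b) (hb : ∀ U e, ‖g U e‖ ≤ b)
    {ε' κ' : ℝ} (hκ' : 0 < κ') {g' : GaugeConfig d L (Circle) → Edge d L → ℝ} (hg' : Measurable g')
    (n' : ℕ) :
    ∃ δ : ℝ, 0 < δ ∧ δ ≤ 1 ∧
      ∀ (μ₀ : Measure (GaugeConfig d L (Circle))) [IsProbabilityMeasure μ₀]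
        (t : ℕ) (A : Set (GaugeConfig d L (Circle))),
        |((fun m : Measure (GaugeConfig d L (Circle)) =>
              m.bind (u1LeapfrogHMCN ε' κ' hg' (fun U => β * wilsonAction ρ U) n' ∘ₖ
                u1LeapfrogHMCN ε κ hg (fun U => β * wilsonAction ρ U) n))^[t] μ₀).real A
            - (wilsonMeasure ρ β).real A| ≤ (1 - δ) ^ t := by
  obtain ⟨s, hs⟩ := exists_bound_smul_wilsonAction_circle (d := d) (L := L) ρ hρ β
  rw [← u1GibbsLaw_eq_wilsonMeasure (d := d) (L := L) ρ β]
  exact u1LeapfrogHMCN_shortLong_uniformlyErgodic hε hκ hn hg hgK hshort hb0 hb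
    (continuous_smul_wilsonAction ρ hρ β).measurable hs hκ' hg' n'

end Wilson

end Summit.Ventures.LatticeQCDFlow.Exactness
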